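import Literature.MathematicalPhysics.QuantumFieldTheory.Balaban1983to89.B8Eq1101DentedCubeMemberCommutator
import Literature.MathematicalPhysics.QuantumFieldTheory.Balaban1983to89.B8Eq1101CubeMemberReal
import Literature.MathematicalPhysics.QuantumFieldTheory.Balaban1983to89.B8Ineq198MultiLevelBoxL0

/-!
# `Balaban1983to89.B8Eq1101DentedCubeMemberReal` — [Balaban1985RegularSpaces] (1.101) AT `U₀ = 1` ON THE DENTED CUBE MEMBER `{Ω′_j}` OF [Balaban1985Variational] (148)–(150):
# `|G′(1)ρ′| ≤ B_G·sup_j sup_{Ω′_j}(Lʲη)²|ρ′|` for the Dirichlet site operator `T` of the p6 flat consumer on the DENTED cells — the FUNCTION member of REAL-1, by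
# dag-n05-c's two-region parametrix run at the dented L0 box member (dented twin of F4c `B8Eq1101CubeMemberReal.ineq1101_cubeMember_sup`)

statement-level skeleton of published theorems with citation tags; proofs where landed; nothing here is a claim about the Yang–Mills mass gap

`[Balaban1985RegularSpaces]` ("B8" = [6], CMP **99** (1985) 75–102) (1.101) p. 93, (1.91)–(1.92) p. 91, p. 98, (1.131) p. 99, (1.4) p. 77; `[Balaban1985BackgroundPropagators]`
([4], CMP **99** (1985) 389–434) Theorem 3.1 (3.42) p. 397, (3.47) p. 398; `[Balaban1984PropagatorsII]` ("B6", CMP **96** (1984) 223–250) p. 228, (2.47)–(2.58) p. 231–233,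
Prop. 2.2 (2.67) p. 234; `[Balaban1985Variational]` ("[15]", CMP **102** (1985) 277–309) (148)–(151) p. 301, p. 300.  PDF held: `paper:balaban1985-cmp99-regular-spaces-gauge-fixing`,
`paper:balaban1985-cmp102-variational-background`, `paper:balaban1984-cmp96-propagators-rt-ii`.

CITATION HEADER (lean-in-tree rule).  Cell `pub-ymgap` (YM Track A, HUMAN RULING D-0062), DAG node N05 = [B8], seat `pub-ymgap-dag-n05-e` (g32; FAN-OUT §N05 row s3b,
Proposition-6 lane; piece (d2-f) of the (β) road — the dented parametrix, file 4: g31 HANDOFF «Next 1 (iii)», dag-n05-c STANDING GO I.42366, this seat INTENT I.43617).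
WHY THIS FILE.  The (β) crown's last named facts `Real1DentedCubeMemberPrinted` ∕ `Real1M4DentedCubeMemberPrinted` (p669491) are [4] Thm 3.1 ∕ [6] (1.101) for `T⁻¹` on
[15]'s `{Ω′_j}`.  THIS FILE proves the FUNCTION member in F4c's general-weights shape (the printed weights are substituted in the last file of the unit), by F4c's proof
token for token at the dented L0 box member `(cubeTDomainsDented … (boxP …) …).toDomains` (files 1–3 of this unit supply the parametrix identity, the region bounds, the
commutator bound; r05's L0 reading `B8Ineq198MultiLevelBoxL0.ineq1101_multiLevelBox_two` is region A's estimate; F4c's `apriori_functional_bound`, `dite_shift_apply` are USED by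
name).  The only change of shape: the p21 weight windows are required at EVERY level (`[4, 8]` for `a`, `[8, 32∕3]` for `c`, the recursion for all `i`) — the L0 reading —
which the printed sequence meets (G10's `awPrinted_window_all ∕ cPrinted_window ∕ awPrinted_succ_all`).

WHAT THIS FILE PROVES (kernel-checked).  ★★★ `ineq1101_dentedCubeMember_sup (d ℓ) (hℓ : 1 ≤ ℓ)` — as displayed in its docstring.
HONEST SCOPE ∕ NOT CLAIMED.  The estimates are p21∕r05's (region A) and F3's (region B); this file's content is F4c's transfer on the dented member; count-neutral; N05 ∕ N07 NOT
discharged; one finite `T⁴` programme at fixed `ε`, Bałaban as printed; nothing continuum ∕ ℝ⁴ ∕ OS ∕ mass-gap ∕ Clay.  No `sorry`, no `def`, no `instance`, no `notation`.  Unit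
`pub-ymgap-dag-n05-e` (g32), 2026-08-28.

RELATED IN THE TREE, NOT DUPLICATED (`rg -l 'Eq1101DentedCubeMemberReal' Balaban1983to89` = 0, 2026-08-28T23:00Z): F4c `B8Eq1101CubeMemberReal` (dag-n05-c; the PURE twin —
§1–§2 USED by name, §3 the model), files 1–3 of this unit (g32; USED), r05 `B8Ineq198MultiLevelBoxL0` (USED), `B8CubeMemberTorusDomainsDented` (g31; USED).
-/
noncomputable section

namespace Literature.MathematicalPhysics.QuantumFieldTheory.Balaban1983to89.B8Eq1101DentedCubeMemberReal

open scoped Matrix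
open B6MultiLevelBoxOperator (N0 mlOp gml levC)
open B6Prop22DerivMultiLevelBox (dMat)
open B6Ineq243TwoLevelBox (aNext)
open B4Reflection242 (boxDom)
open B7Prop1Explicit (e)
open B8Eq131Cubes (cube)
open B8LambdaSpaceKLevel (wt)
open B8Eq191FlatDirichletForm (isUnit_flatMatrix)
open B8CubeMemberBoxDomains (shift boxP)
open B8CubeMemberTorusDomainsDented (cubeTDomainsDented levD hΩ_of_anchored)
open B8Eq191FlatLettersDentedCubeMember (sq_subset_zero)
open B8Eq1101CubeMemberCutoffs (cutA cutAt cutB cutBt wall wall_subset)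
open B8Eq1101CubeMemberParametrixIdentity (parametrix_sup)
open B8Eq1101DentedCubeMemberParametrixIdentity (parametrix_identity regionA_bounds regionB_bound)
open B8Eq1101DentedCubeMemberCommutator (commutator_bound)
open B8Eq1101CubeMemberReal (apriori_functional_bound dite_shift_apply)
open B8Ineq198MultiLevelBoxL0 (ineq1101_multiLevelBox_two)
open Node00 (CubeB8D)
open Literature.MathematicalPhysics.QuantumLattice (blockMap)

variable {d : ℕ}

open Classical in
/-- **[Balaban1985RegularSpaces] (1.101) AT `U₀ = 1` ON THE DENTED CUBE MEMBER `{Ω′_j}` OF [Balaban1985Variational] (148)–(150) — THE FUNCTION MEMBER OF THE REAL-1 FAMILY,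
TOP TRUNCATION** («G′ is a bounded operator from a space with the norm |·|₍₋₂₎ into a space with the norm |·| for functions»; [4] Theorem 3.1 at `U = 1` for «the sequence
{Ω′_j} instead of {Ω_j}», [15] p. 301).  There are `B_G, ρ₀, M₀ > 0` and `N₀ ≥ 1`, depending on `d, ℓ` only, such that: for every `η > 0`, every big-block size `M_h ≥ 3` with
`M₀ ≤ L·M_h` (`L = ℓ + 1`), every DENTED cube datum `c : CubeB8D (d+1) (ℓ+1) K Ω` on print's sub-lattice (`M_hL ∣ c.ρ`, `M_hL ∣ c.M`, `R·M_hL ≤ c.ρ`, `2L ≤ R`, `N₀ + 1 ≤ R·L·M_h`,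
`ρ₀ ≤ c.ρ`) whose ambient top member `Ω_k` is a union of `M_hL^{k+1}`-cubes anchored at `□_k`'s corner, every p21 weight sequence in the windows `[4, 8]`, `[8, 32∕3]` with its
recursion at EVERY level (the L0 reading), every consumer weight sequence `w > 0` with `w_j·L^{−2(d+1)j} = η⁻²·levC_j` (ALL `j ≤ k`) and normalised weights in `[4, 8]`, the
explicit matrix `T = (K(x,z))` of the consumer on `S = Ω′₀ = □₀` with the dented cells `c.lamS`, and every source `ρ′` with `(Lʲη)²|ρ′| ≤ r` on `Ω′_j` (`j ≤ k`): the solution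
`φ = T⁻¹ρ′` (extended by `0` off `□₀`) satisfies `|φ(x)| ≤ B_G·r`.  PROOF = dag-n05-c's F4c verbatim at the dented L0 box member: two-region parametrix `T·P = 1 + K₁` (file 2
of this unit) with region A = r05's hypothesis-free L0 reading `B8Ineq198MultiLevelBoxL0.ineq1101_multiLevelBox_two` at `(cubeTDomainsDented … (boxP …) …).toDomains`, region B =
the wall (F3, file 1 of this unit), ramp length `s ≥ 20(d+1)L²(C′_A + C_B)` so that `‖K₁‖₍₋₂₎ ≤ ½`, and F4c's a-priori inversion `apriori_functional_bound`.
[cite: Balaban1985RegularSpaces, (1.101) p.93, p.98, (1.131) p.99, (1.4) p.77; Balaban1985BackgroundPropagators, Theorem 3.1 (3.42) p.397, (3.47) p.398; Balaban1985Variational, (148)–(151) p.301; Balaban1984PropagatorsII, p.228, (2.47)–(2.58) p.231–233, Prop. 2.2 (2.67) p.234] -/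
theorem ineq1101_dentedCubeMember_sup (d ℓ : ℕ) (hℓ : 1 ≤ ℓ) :
    ∃ BG ρ₀ M₀ : ℝ, ∃ N₀ : ℕ, 0 < BG ∧ 0 < M₀ ∧ 0 < N₀ ∧
      ∀ (η : ℝ), 0 < η → ∀ (Mh : ℕ), 3 ≤ Mh → M₀ ≤ ((ℓ : ℝ) + 1) * Mh →
      ∀ (K' : ℕ) (Ω : ℕ → Set (Fin (d + 1) → ℤ)) (c : CubeB8D (d + 1) (ℓ + 1) K' Ω) (R : ℕ),
        Mh * (ℓ + 1) ∣ c.ρ → Mh * (ℓ + 1) ∣ c.M → R * (Mh * (ℓ + 1)) ≤ c.ρ → 2 * (ℓ + 1) ≤ R → N₀ + 1 ≤ R * ((ℓ + 1) * Mh) → ρ₀ ≤ (c.ρ : ℝ) →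
        (∀ x y : Fin (d + 1) → ℤ,
            blockMap (Mh * (ℓ + 1) ^ (c.k + 1)) (x - fun i => (((ℓ + 1 : ℕ) : ℤ)) ^ c.k * (c.a i - c.ρ)) =
              blockMap (Mh * (ℓ + 1) ^ (c.k + 1)) (y - fun i => (((ℓ + 1 : ℕ) : ℤ)) ^ c.k * (c.a i - c.ρ)) → x ∈ Ω c.k → y ∈ Ω c.k) →
      ∀ (aw cw : ℕ → ℝ), (∀ i, 4 ≤ aw i ∧ aw i ≤ 8) → (∀ i, 8 ≤ cw i ∧ cw i ≤ 32 / 3) →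
        (∀ i, aw (i + 1) = aNext ℓ (aw i) (cw i)) → (∀ j, 0 < aw j) →
      ∀ (w : ℕ → ℝ), (∀ j, 0 < w j) →
        (∀ j, j ≤ c.k → w j * (((((ℓ + 1 : ℕ) : ℝ) ^ (d + 1))⁻¹) ^ j) ^ 2 = (η ^ 2)⁻¹ * levC d ℓ aw j) →
        (∀ j, j ≤ c.k → 4 ≤ w j * η ^ 2 * (((ℓ + 1 : ℕ) : ℝ) ^ j) ^ 2 * (((((ℓ + 1 : ℕ) : ℝ)) ^ (d + 1)) ^ j)⁻¹ ∧
          w j * η ^ 2 * (((ℓ + 1 : ℕ) : ℝ) ^ j) ^ 2 * (((((ℓ + 1 : ℕ) : ℝ)) ^ (d + 1)) ^ j)⁻¹ ≤ 8) →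
      ∀ (S : Finset (Fin (d + 1) → ℤ)), (∀ z, z ∈ S ↔ z ∈ c.sq 0) →
      ∀ (K : (Fin (d + 1) → ℤ) → (Fin (d + 1) → ℤ) → ℝ), (∀ x z, K x z =
          ((η ^ 2)⁻¹ * ∑ μ : Fin (d + 1), ((2 : ℝ) * (if z = x then (1 : ℝ) else 0) - (if z = x + e μ then (1 : ℝ) else 0)
            - (if z = x - e μ then (1 : ℝ) else 0))) +
          (∑ j ∈ Finset.range (c.k + 1), (if blockMap ((ℓ + 1) ^ j) x ∈ c.lamS j ∧
              blockMap ((ℓ + 1) ^ j) z = blockMap ((ℓ + 1) ^ j) x then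
            w j * (((((ℓ + 1 : ℕ) : ℝ) ^ (d + 1))⁻¹) ^ j) ^ 2 else 0))) →
      ∀ (T : Matrix ↥S ↥S ℝ), T = Matrix.of (fun x z : ↥S => K x.1 z.1) →
      ∀ (ρ' : ↥S → ℝ) (r : ℝ), 0 ≤ r →
        (∀ j, j ≤ c.k → ∀ z : ↥S, z.1 ∈ c.sq j → wt (ℓ + 1) η j ^ 2 * |ρ' z| ≤ r) →
        ∀ φ : (Fin (d + 1) → ℤ) → ℝ, (∀ x, x ∉ c.sq 0 → φ x = 0) →
          (∀ v : ↥S, φ v.1 = ∑ z : ↥S, T⁻¹ v z * ρ' z) →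
          ∀ x, |φ x| ≤ BG * r := by
  have hd : 0 < d + 1 := Nat.succ_pos d
  have hL : 1 ≤ ℓ + 1 := Nat.succ_pos ℓ
  have hLr : (1 : ℝ) ≤ ((ℓ + 1 : ℕ) : ℝ) := by exact_mod_cast hL
  have hLpos : (0 : ℝ) < ((ℓ + 1 : ℕ) : ℝ) := by positivity
  -- region A's (1.101) package: r05's HYPOTHESIS-FREE L0 reading (generic in the box member), weight windows `[4, 8]`, `[8, 32/3]`
  obtain ⟨C', M₀, N₀, hC', hM₀, hN₀, hregA⟩ := ineq1101_multiLevelBox_two d ℓ hℓ 4 8 8 (32 / 3) (by norm_num) (by norm_num)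
  -- the wall constant (F3 at `a₀ = 4`, `θ = ½`, `δ′ = 1/(2(d+1))`)
  set CW : ℝ := (((ℓ + 1 : ℕ) : ℝ)) ^ 2 / (4 * (1 - 1 / 2)) * B6.c0 1 (1 / (2 * ((d : ℝ) + 1)) / ((ℓ + 1 : ℕ) : ℝ)) ^ (d + 1) with hCW
  have hc0 : 1 ≤ B6.c0 1 (1 / (2 * ((d : ℝ) + 1)) / ((ℓ + 1 : ℕ) : ℝ)) := B8Eq191FlatDirichletWall.one_le_c0 (by positivity)
  have hCW0 : 0 ≤ CW := by rw [hCW]; have := hc0; positivity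
  -- the ramp-length threshold and the collar threshold
  set s₀ : ℝ := 20 * ((d : ℝ) + 1) * (((ℓ + 1 : ℕ) : ℝ)) ^ 2 * (C' + CW) with hs₀
  have hs₀0 : 0 ≤ s₀ := by rw [hs₀]; positivity
  set ρ₀ : ℝ := 4 * s₀ + 12 + ((d : ℝ) + 1) * ℓ with hρ₀
  refine ⟨2 * (C' + CW), ρ₀, M₀, N₀, by positivity, hM₀, hN₀, ?_⟩
  intro η hη Mh hMh hM0 K' Ω c R hρd hMd hR hR2 hRN hρbig hanch aw cw haw hc hrec hawpos w hwpos hw hwin S hS K hK T hT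
    ρ' r hr hρ' φ hφ0 hφ x₀
  have hη0 : η ≠ 0 := hη.ne'
  have hMh1 : 1 ≤ Mh := le_trans (by norm_num) hMh
  have hMh2 : 2 ≤ Mh := le_trans (by norm_num) hMh
  have hk : 1 ≤ c.k := c.one_le_k
  have hρL : ℓ + 1 ≤ c.ρ := c.L_le_ρ
  have hρ0 : 0 < c.ρ := lt_of_lt_of_le (Nat.succ_pos ℓ) hρL
  -- the dented L0 box member (r03's `toDomains` of g31's torus member at the exact host), its premise from the anchored one
  have hΩc := hΩ_of_anchored (Mh := Mh) hMh1 c (fun x x' hxx => hanch x x' (by simpa only [B6MultiLevelBoxOperator.bigSide] using hxx))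
  set DL := (cubeTDomainsDented hℓ hMh2 c hρd hMd hR (boxP ℓ c.M c.ρ c.k c.k) (fun _ => le_rfl) hΩc).toDomains with hDL
  have hlevDL : DL.lev = levD Mh c := rfl
  have hPbox : ∀ μ' : Fin (d + 1), 1 ≤ boxP (d := d) ℓ c.M c.ρ c.k c.k μ' := fun μ' => le_trans hρ0 (Nat.le_add_right _ _)
  -- the ramp length `s` and the wall parameter `m_W = 4s`
  obtain ⟨s, hs⟩ : ∃ s : ℕ, s = (c.ρ * (ℓ + 1) - (d + 1) * ℓ) / 4 := ⟨_, rfl⟩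
  have hρL' : (d + 1) * ℓ + 4 * (Nat.ceil s₀ + 1) ≤ c.ρ * (ℓ + 1) := by
    have h1 : (c.ρ : ℝ) ≤ (c.ρ : ℝ) * ((ℓ + 1 : ℕ) : ℝ) := le_mul_of_one_le_right (by positivity) hLr
    have h2 : ((Nat.ceil s₀ : ℕ) : ℝ) < s₀ + 1 := Nat.ceil_lt_add_one hs₀0
    have h3 : (((d + 1) * ℓ + 4 * (Nat.ceil s₀ + 1) : ℕ) : ℝ) ≤ ((c.ρ * (ℓ + 1) : ℕ) : ℝ) := by
      push_cast; rw [hρ₀] at hρbig; push_cast at h1; nlinarith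
    exact_mod_cast h3
  have hs_ge : Nat.ceil s₀ + 1 ≤ s := by
    rw [hs, Nat.le_div_iff_mul_le (by norm_num)]; omega
  have hs1 : 1 ≤ s := le_trans (by omega) hs_ge
  have hss₀ : s₀ ≤ s := (Nat.le_ceil s₀).trans (by exact_mod_cast (by omega : Nat.ceil s₀ ≤ s))
  have hs4 : 4 * s + (d + 1) * ℓ ≤ c.ρ * (ℓ + 1) := by
    rw [hs]; have := Nat.div_mul_le_self (c.ρ * (ℓ + 1) - (d + 1) * ℓ) 4; omega
  have hmWρ : ((4 * s : ℕ) : ℤ) + (d + 1 : ℕ) * ((ℓ + 1 : ℕ) - 1 : ℤ) ≤ c.ρ * (ℓ + 1 : ℕ) := by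
    have : (((4 * s + (d + 1) * ℓ : ℕ)) : ℤ) ≤ ((c.ρ * (ℓ + 1) : ℕ) : ℤ) := by exact_mod_cast hs4
    push_cast at this ⊢; linarith
  have hρs : 4 * (s : ℤ) ≤ c.ρ * (ℓ + 1 : ℕ) := by
    have : (((4 * s : ℕ)) : ℤ) ≤ ((c.ρ * (ℓ + 1) : ℕ) : ℤ) := by exact_mod_cast (le_trans (Nat.le_add_right _ _) hs4)
    push_cast at this ⊢; linarith
  have hs0r : (0 : ℝ) < s := by exact_mod_cast hs1
  -- the size predicate and the explicit operators of the parametrix, as functions of the source `u`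
  obtain ⟨BW, hBW⟩ : ∃ BW : ((Fin (d + 1) → ℤ) → ℝ) → ℝ → Prop,
      ∀ u N, BW u N ↔ ∀ j, j ≤ c.k → ∀ z, z ∈ c.sq j → ((((ℓ + 1 : ℕ) : ℝ)) ^ j * η) ^ 2 * |u z| ≤ N :=
    ⟨fun u N => ∀ j, j ≤ c.k → ∀ z, z ∈ c.sq j → ((((ℓ + 1 : ℕ) : ℝ)) ^ j * η) ^ 2 * |u z| ≤ N, fun _ _ => Iff.rfl⟩
  obtain ⟨uAf, huAf⟩ : ∃ uAf : ((Fin (d + 1) → ℤ) → ℝ) → ↥(boxDom (N0 ℓ Mh c.k (boxP ℓ c.M c.ρ c.k c.k))) → ℝ,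
      ∀ u y, uAf u y = cutA hd (ℓ + 1) c.a c.M c.ρ c.k s (y.1 - shift ℓ Mh c.a c.ρ c.k c.k) * u (y.1 - shift ℓ Mh c.a c.ρ c.k c.k) := ⟨_, fun _ _ => rfl⟩
  obtain ⟨gAxf, hgAxf⟩ : ∃ gAxf : ((Fin (d + 1) → ℤ) → ℝ) → (Fin (d + 1) → ℤ) → ℝ,
      ∀ u z, gAxf u z = if h : z + shift ℓ Mh c.a c.ρ c.k c.k ∈ boxDom (N0 ℓ Mh c.k (boxP ℓ c.M c.ρ c.k c.k)) then
        (gml (N0 ℓ Mh c.k (boxP ℓ c.M c.ρ c.k c.k)) ℓ c.k (levD Mh c) aw *ᵥ uAf u) ⟨z + shift ℓ Mh c.a c.ρ c.k c.k, h⟩ else 0 := ⟨_, fun _ _ => rfl⟩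
  obtain ⟨uBf, huBf⟩ : ∃ uBf : ((Fin (d + 1) → ℤ) → ℝ) → ↥(wall hd (ℓ + 1) c.a c.M c.ρ c.k S (4 * s)) → ℝ,
      ∀ u y, uBf u y = cutB hd (ℓ + 1) c.a c.M c.ρ c.k s y.1 * u y.1 := ⟨_, fun _ _ => rfl⟩
  obtain ⟨gBxf, hgBxf⟩ : ∃ gBxf : ((Fin (d + 1) → ℤ) → ℝ) → (Fin (d + 1) → ℤ) → ℝ,
      ∀ u z, gBxf u z = if h : z ∈ wall hd (ℓ + 1) c.a c.M c.ρ c.k S (4 * s) then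
        (((Matrix.of fun x z : ↥(wall hd (ℓ + 1) c.a c.M c.ρ c.k S (4 * s)) => K x.1 z.1)⁻¹) *ᵥ uBf u) ⟨z, h⟩ else 0 := ⟨_, fun _ _ => rfl⟩
  obtain ⟨Pf, hPf⟩ : ∃ Pf : ((Fin (d + 1) → ℤ) → ℝ) → (Fin (d + 1) → ℤ) → ℝ,
      ∀ u z, Pf u z = cutAt hd (ℓ + 1) c.a c.M c.ρ c.k s z * (η ^ 2 * gAxf u z) + cutBt hd (ℓ + 1) c.a c.M c.ρ c.k s z * gBxf u z := ⟨_, fun _ _ => rfl⟩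
  obtain ⟨K₁, hK₁⟩ : ∃ K₁ : ((Fin (d + 1) → ℤ) → ℝ) → (Fin (d + 1) → ℤ) → ℝ,
      ∀ u x, K₁ u x = ∑ z ∈ S, K x z * ((cutAt hd (ℓ + 1) c.a c.M c.ρ c.k s z - cutAt hd (ℓ + 1) c.a c.M c.ρ c.k s x) * (η ^ 2 * gAxf u z)
        + (cutBt hd (ℓ + 1) c.a c.M c.ρ c.k s z - cutBt hd (ℓ + 1) c.a c.M c.ρ c.k s x) * gBxf u z) := ⟨_, fun _ _ => rfl⟩
  obtain ⟨ψ, hψ⟩ : ∃ ψ : ((Fin (d + 1) → ℤ) → ℝ) → (Fin (d + 1) → ℤ) → ℝ,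
      ∀ u x, ψ u x = if h : x ∈ S then ∑ z : ↥S, T⁻¹ ⟨x, h⟩ z * u z.1 else 0 := ⟨_, fun _ _ => rfl⟩
  -- facts about the explicit objects
  have hgAx_pull : ∀ u (y : ↥(boxDom (N0 ℓ Mh c.k (boxP ℓ c.M c.ρ c.k c.k)))),
      gAxf u (y.1 - shift ℓ Mh c.a c.ρ c.k c.k) = (gml (N0 ℓ Mh c.k (boxP ℓ c.M c.ρ c.k c.k)) ℓ c.k (levD Mh c) aw *ᵥ uAf u) y := by
    intro u y
    have h := dite_shift_apply (shift ℓ Mh c.a c.ρ c.k c.k) (gml (N0 ℓ Mh c.k (boxP ℓ c.M c.ρ c.k c.k)) ℓ c.k (levD Mh c) aw *ᵥ uAf u) y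
    rw [hgAxf]; exact h
  have hgBx_mem : ∀ u (y : ↥(wall hd (ℓ + 1) c.a c.M c.ρ c.k S (4 * s))),
      gBxf u y.1 = (((Matrix.of fun x z : ↥(wall hd (ℓ + 1) c.a c.M c.ρ c.k S (4 * s)) => K x.1 z.1)⁻¹) *ᵥ uBf u) y := by
    intro u y; rw [hgBxf, dif_pos y.2]
  have hgBx0 : ∀ u z, z ∉ wall hd (ℓ + 1) c.a c.M c.ρ c.k S (4 * s) → gBxf u z = 0 := by
    intro u z hz; rw [hgBxf, dif_neg hz]
  have hw0 : ∀ j, 0 ≤ w j := fun j => (hwpos j).le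
  -- (i) the bounds of the two regions for a source of size `N`
  have hregA' : ∀ (f : ↥(boxDom (N0 ℓ Mh c.k (boxP ℓ c.M c.ρ c.k c.k))) → ℝ) (S' : ℝ), 0 ≤ S' →
      (∀ z : ↥(boxDom (N0 ℓ Mh c.k (boxP ℓ c.M c.ρ c.k c.k))), |f z| ≤ S' * ((((ℓ : ℝ) + 1) ^ levD Mh c z.1) ^ 2)⁻¹) →
      ∀ y : ↥(boxDom (N0 ℓ Mh c.k (boxP ℓ c.M c.ρ c.k c.k))),
        |(gml (N0 ℓ Mh c.k (boxP ℓ c.M c.ρ c.k c.k)) ℓ c.k (levD Mh c) aw *ᵥ f) y| ≤ C' * S' ∧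
        ∀ μ : Fin (d + 1), |(dMat (N0 ℓ Mh c.k (boxP ℓ c.M c.ρ c.k c.k)) μ *ᵥ (gml (N0 ℓ Mh c.k (boxP ℓ c.M c.ρ c.k c.k)) ℓ c.k (levD Mh c) aw *ᵥ f)) y|
          ≤ C' * (((ℓ : ℝ) + 1) ^ levD Mh c y.1)⁻¹ * S' := by
    intro f S' hS' hf y
    obtain ⟨h1, h2, -, -⟩ := hregA c.k Mh R hMh hM0 hR2 hRN (boxP ℓ c.M c.ρ c.k c.k) hPbox DL aw cw haw hc hrec f S' hS' hf y
    exact ⟨h1, h2⟩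
  have hcubeS : ∀ j, j ≤ c.k → ∀ z, z ∈ c.sq j → z ∈ S := fun j _ z hz => (hS z).mpr (sq_subset_zero c j hz)
  have hAbound : ∀ u N, 0 ≤ N → BW u N → ∀ z, η ^ 2 * |gAxf u z| ≤ C' * N := by
    intro u N hN hu z
    rw [hBW] at hu
    rw [hgAxf]
    split_ifs with h
    · exact (regionA_bounds c hη aw hregA' hs1 u hN hu (uAf u) (huAf u) ⟨_, h⟩).1
    · rw [abs_zero, mul_zero]; positivity
  have hAgrad : ∀ u N, 0 ≤ N → BW u N → ∀ (y : ↥(boxDom (N0 ℓ Mh c.k (boxP ℓ c.M c.ρ c.k c.k)))) (μ : Fin (d + 1)),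
      η ^ 2 * |(dMat (N0 ℓ Mh c.k (boxP ℓ c.M c.ρ c.k c.k)) μ *ᵥ (gml (N0 ℓ Mh c.k (boxP ℓ c.M c.ρ c.k c.k)) ℓ c.k (levD Mh c) aw *ᵥ uAf u)) y|
        ≤ C' * N * (((ℓ : ℝ) + 1) ^ levD Mh c y.1)⁻¹ := by
    intro u N hN hu y μ
    rw [hBW] at hu
    exact (regionA_bounds c hη aw hregA' hs1 u hN hu (uAf u) (huAf u) y).2 μ
  have hBbound : ∀ u N, 0 ≤ N → BW u N → ∀ z, |gBxf u z| ≤ CW * N := by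
    intro u N hN hu z
    rw [hBW] at hu
    rw [hgBxf]
    split_ifs with h
    · have hb := regionB_bound c hη0 w hwpos K hK S hS (a₀ := 4) (by norm_num) (by norm_num)
        (fun j hj => (hwin j hj).1) (fun j hj => (hwin j hj).2) (s := s) (mW := 4 * s) hmWρ u hN hu (uBf u) (huBf u) ⟨z, h⟩
      rw [hCW]; exact hb
    · rw [abs_zero]; positivity
  -- (ii) `|P u| ≤ (C′ + C_W)N`
  have hPbound : ∀ u N, 0 ≤ N → BW u N → ∀ x, |Pf u x| ≤ (C' + CW) * N := by
    intro u N hN hu x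
    rw [hPf]
    have h := parametrix_sup hd (ℓ + 1) c.a c.M c.ρ c.k s (η := η) (gAxf u) (gBxf u) (hAbound u N hN hu) (hBbound u N hN hu) x
    linarith
  -- (iii) `K₁` halves the size
  have hKhalf : ∀ u N, 0 ≤ N → BW u N → BW (K₁ u) (N / 2) := by
    intro u N hN hu
    rw [hBW]
    intro j hj z hz
    have hzS : z ∈ S := hcubeS j hj z hz
    have hcb := commutator_bound c hη0 w aw hw0 (by linarith [(haw 1).1]) (haw 1).2 hw K hK S hS hs1 hρs
      (gAxf u) (gBxf u) (A := C' * N) (B := CW * N) (by positivity) (by positivity) (hAbound u N hN hu) (hBbound u N hN hu)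
      (fun z hz => hgBx0 u z (fun h => hz (wall_subset hd (ℓ + 1) c.a c.M c.ρ c.k S (4 * s) h))) hzS hj hz
    rw [hK₁]
    refine hcb.trans ?_
    -- `10(d+1)L²(C′+C_W)N/s ≤ N/2` since `s ≥ s₀ = 20(d+1)L²(C′+C_W)`
    rw [div_le_iff₀ hs0r]
    have : 10 * ((d : ℝ) + 1) * (((ℓ + 1 : ℕ) : ℝ)) ^ 2 * (C' * N + CW * N) = (s₀ / 2) * N := by rw [hs₀]; ring
    rw [this]
    have hN2 : 0 ≤ N / 2 := by positivity
    nlinarith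
  -- (iv) the identity `ψ u x = P u x − ψ (K₁u) x` on `S`, from `T·P = 1 + K₁` and `T⁻¹T = 1`
  have hTunit : IsUnit T := by rw [hT]; exact isUnit_flatMatrix hd hη0 (ℓ + 1) c.k c.lamS w hw0 K hK S
  have hTT : T⁻¹ * T = 1 := Matrix.nonsing_inv_mul T ((Matrix.isUnit_iff_isUnit_det T).mp hTunit)
  have hident : ∀ u (x : ↥S), ψ u x.1 = Pf u x.1 - ψ (K₁ u) x.1 := by
    intro u x
    -- `T·(P u) = u + K₁u` at every row
    have hrow : ∀ z : ↥S, ∑ y : ↥S, T z y * Pf u y.1 = u z.1 + K₁ u z.1 := by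
      intro z
      have hpi := parametrix_identity hℓ hMh2 c DL hlevDL hη0 w aw hw0 hawpos hw K hK S hS hs1 (mW := 4 * s) le_rfl u
        (uAf u) (huAf u) (gAxf u) (hgAx_pull u) (uBf u) (huBf u) (gBxf u) (hgBx_mem u) (hgBx0 u) z.2
      rw [hK₁, ← hpi, ← Finset.sum_coe_sort S]
      refine Finset.sum_congr rfl fun y _ => ?_
      rw [hT, Matrix.of_apply, hPf]
    -- apply `T⁻¹`
    have h1 : ∑ z : ↥S, T⁻¹ x z * (u z.1 + K₁ u z.1) = Pf u x.1 := by
      calc ∑ z : ↥S, T⁻¹ x z * (u z.1 + K₁ u z.1)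
          = ∑ z : ↥S, T⁻¹ x z * ∑ y : ↥S, T z y * Pf u y.1 := Finset.sum_congr rfl fun z _ => by rw [hrow z]
        _ = ∑ y : ↥S, (∑ z : ↥S, T⁻¹ x z * T z y) * Pf u y.1 := by
            simp_rw [Finset.mul_sum]
            rw [Finset.sum_comm]
            refine Finset.sum_congr rfl fun y _ => ?_
            rw [Finset.sum_mul]
            refine Finset.sum_congr rfl fun z _ => ?_
            ring
        _ = ∑ y : ↥S, (T⁻¹ * T) x y * Pf u y.1 := Finset.sum_congr rfl fun y _ => by rw [Matrix.mul_apply]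
        _ = Pf u x.1 := by
            rw [hTT]
            simp_rw [Matrix.one_apply, ite_mul, one_mul, zero_mul]
            rw [Finset.sum_ite_eq]; simp
    have hψx : ψ u x.1 = ∑ z : ↥S, T⁻¹ x z * u z.1 := by rw [hψ, dif_pos x.2]
    have hψK : ψ (K₁ u) x.1 = ∑ z : ↥S, T⁻¹ x z * K₁ u z.1 := by rw [hψ, dif_pos x.2]
    rw [hψx, hψK, ← h1, ← Finset.sum_sub_distrib]
    refine Finset.sum_congr rfl fun z _ => ?_
    ring
  -- (v) the crude bound
  have hcrude : ∀ (x : ↥S) u N, 0 ≤ N → BW u N → |ψ u x.1| ≤ ((η ^ 2)⁻¹ * ∑ z : ↥S, |T⁻¹ x z|) * N := by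
    intro x u N hN hu
    rw [hBW] at hu
    rw [hψ, dif_pos x.2, Finset.mul_sum, Finset.sum_mul]
    refine (Finset.abs_sum_le_sum_abs _ _).trans (Finset.sum_le_sum fun z _ => ?_)
    rw [abs_mul]
    have hz0 : z.1 ∈ c.sq 0 := (hS z.1).mp z.2
    have hb := hu 0 (Nat.zero_le _) z.1 hz0
    rw [pow_zero, one_mul] at hb
    have hη2 : 0 < η ^ 2 := by positivity
    have : |u z.1| ≤ (η ^ 2)⁻¹ * N := by rw [le_inv_mul_iff₀ hη2]; exact hb
    calc |T⁻¹ x z| * |u z.1| ≤ |T⁻¹ x z| * ((η ^ 2)⁻¹ * N) := mul_le_mul_of_nonneg_left this (abs_nonneg _)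
      _ = (η ^ 2)⁻¹ * |T⁻¹ x z| * N := by ring
  -- (vi) the source `ρ′` extended by zero, of size `r`
  obtain ⟨u₀, hu₀⟩ : ∃ u₀ : (Fin (d + 1) → ℤ) → ℝ, ∀ z, u₀ z = if h : z ∈ S then ρ' ⟨z, h⟩ else 0 := ⟨_, fun _ => rfl⟩
  have hBWu₀ : BW u₀ r := by
    rw [hBW]
    intro j hj z hz
    have hzS : z ∈ S := hcubeS j hj z hz
    rw [hu₀, dif_pos hzS]
    have h := hρ' j hj ⟨z, hzS⟩ hz
    simpa [wt] using h
  -- conclusion at `x₀`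
  by_cases hx₀ : x₀ ∈ S
  · have hmain := apriori_functional_bound BW K₁ (fun u => ψ u x₀) (fun u => Pf u x₀) (C := C' + CW)
      (B₀ := (η ^ 2)⁻¹ * ∑ z : ↥S, |T⁻¹ ⟨x₀, hx₀⟩ z|) (by positivity)
      (fun u => hident u ⟨x₀, hx₀⟩) (fun u N hN hu => hPbound u N hN hu x₀) hKhalf (fun u N hN hu => hcrude ⟨x₀, hx₀⟩ u N hN hu)
      u₀ hr hBWu₀
    have hφψ : φ x₀ = ψ u₀ x₀ := by
      rw [hφ ⟨x₀, hx₀⟩, hψ, dif_pos hx₀]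
      refine Finset.sum_congr rfl fun z _ => ?_
      rw [hu₀, dif_pos z.2]
    rw [hφψ]
    simpa [mul_assoc] using hmain
  · rw [hφ0 x₀ (fun h => hx₀ ((hS x₀).mpr h)), abs_zero]
    positivity

end Literature.MathematicalPhysics.QuantumFieldTheory.Balaban1983to89.B8Eq1101DentedCubeMemberReal
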